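import Literature.AlgebraicGeometry.Hu2025.Statements.S01S09Interface.R110cUniversalityInterface
import Literature.AlgebraicGeometry.Hu2025.Statements.S08MainTheorem.R110dEllTransform
import HarnessLib

/-!
# Hu 2025 (arXiv:2507.21400v1) §9 eq. (9.2) `Γ_d` ON THE PLATFORM of row 101 (and as a subset of `Var_𝐔`, Def. 7.1), the claim
# C72L129, and [Hu22] p.131: the diagram (9.2)/(9.3) as a STRUCTURE and the sentence P131L40 (joint J1 = G-H7's printed reason);
# C09L16 instantiated; PARTITION-HU §7.2's spelling `S01S09Interface.Thm1_3` is served by `export` of file d's `S08MainTheorem.Thm1_3` /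
# `Thm1_3_admitsResolution` (no duplicate constant) — row 110 file `e` = `S01S09Interface/R110eGammaOfMatroid.lean`, STATEMENTS-FIRST (rung M-Hu-min, D-0089).
# PRE-DRAFT by res-type-024 (gen 6; v3.3 gen 11); NOT FILED before the 08:00Z line.

**Status of the sources (D-0012): UNREFEREED PREPRINTS UNDER ADJUDICATION.** [Hu25] = Y. Hu, *Universal
characteristic-free resolution of singularities, I*, arXiv:2507.21400v1 (2025), TeX chunks `p0001…p0073` (locator of
record `chunk p<cc> l.<a>–<b>` = `C<cc>L<l>`, next to it the arXiv-v1 PDF page, cross-checked on the PDF text layer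
`lit/res-lit-6/hu25/text`); [Hu22] = Y. Hu, arXiv:2203.03842v4 (2022), locator `p.N l.a–b` = `Hu22P<ppp>L<l>`. Every
statement is typed as a `def … : Prop` CANDIDATE / real definition / STRUCTURE whose fields quote the printed
requirements, tagged `[claim: Hu2025 | Hu2022, status: under-review]`, consumed only as a hypothesis, never asserted; no
decl takes a side. No proofs, no `sorry`, no `instance`, no notation. AI typing is weaker than expert review.
STATUS: candidate statements under adjudication (D-0012/D-0089); not asserted.

ROW-110 FILE LAYOUT (res-type-024 pre-draft v3, 2026-08-27T05:3xZ; rationale in HOME/plan/tools/res-type-024/hu/README-hu110-bc.md):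
a `S08MainTheorem/R110aSmooth` (I-SM: HuSmooth/Def8_4, IsHuResolution, AdmitsResolution/C71L67, AdmitsResolutionType/C03L19,
IsHuBaseField/C67L4, HuSingular(_reg); deps: tree only) · b `S08MainTheorem/R110bMainTheorems` (§8.1 Lem8_1/Def8_2/Lem8_3
+ the CHART content of Thm 8.5; deps: Mathlib only) · c `S01S09Interface/R110cUniversalityInterface` (§9 matroids,
Prop9_1, Thm9_2/9_3/9_4 over LafforgueObjects; §1 Thm1_1, C09L16, C09L21; [Hu22] Thm1_1, P133L11; deps: a + Mathlib) ·
d `S08MainTheorem/R110dEllTransform` (Z_Γ as a scheme, the ℓ-transform tower STRUCTURE, Thm8_5/Thm8_6/Thm1_3 as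
properties of a tower, the CLOSED platform consequences; deps: a + row 109 I-GA + row 101 I-PL) · e
`S01S09Interface/R110eGammaOfMatroid` (Γ_d on the platform, C72L129, Hu22Setup + Hu22P131L40, C09L16_inst; deps: c + d).

THIS FILE (deps: c `R110cUniversalityInterface` + d `R110dEllTransform` ⇒ a, I-GA, I-PL). Read for it: [Hu25] chunk p0072
(l.126–135), p0057 (l.9–13), p0008 (l.106–116); [Hu22] p.131 (`~/.lit/texts/paper-arxiv-2203.03842/p0131.txt`); PDF p.161, p.17.
[Hu22] p.131 l.40–41 (J1's printed reason) is typed over the STRUCTURE `Hu22Setup` recording diagram (9.2)/(9.3) of [Hu22]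
p.131 with exactly the properties PRINTED there and in Thm 9.4 (`U` open in `X × 𝔸^r` onto `X`; the quotient map
`π : Gr_d ↠ U` surjective; `m` with `x_m ∈ Δ_d`, normalised to `m = (123)` by [Hu25] C72L130 = row 101's chart; «`Gr_d` is an
open subset of the Γ-scheme `Z_Γ ⊂ 𝐔_m`» = an open
immersion into `gammaSpec (primaryFamily n 𝔽) (Γ_d ∩ Var_𝐔)`): `Hu22P131L40 S := IsIntegral X → IsIntegral Z_Γ`. Nothing
beyond the printed properties ties `S` to Lafforgue's construction (there is none in print); EXISTENCE NOT SHOWN here.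
Universe `0` (the platform's `plVar n : Type`).
-/

noncomputable section

open _root_.CategoryTheory _root_.CategoryTheory.Limits _root_.AlgebraicGeometry _root_.MvPolynomial

namespace Literature.AlgebraicGeometry.Hu2025.Statements.S01S09Interface

open Literature.AlgebraicGeometry.Hu2025.Statements.S08MainTheorem
open Literature.AlgebraicGeometry.Hu2025.Statements.S07GammaSchemes
open Literature.AlgebraicGeometry.Hu2025.Statements.S03Pluecker

/-! ## (9.2) `Γ_d` (chunk p0072 l.126–135; PDF p.161 L021) on row 101's index sets -/

/-- **Hu 2025, (9.2), `Γ_d`** (chunk p0072 l.126–135; PDF p.161 L014–L023), verbatim: «Finally, for a given matroid Schubert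
cell `Gr^{3,E}_d`, we specify its corresponding `Γ` as follows. … We define `Γ := Γ_d = {i ∈ 𝕀_{3,n} ∣ x_i ∉ Δ^{3,n}_d}`.»
— LITERALLY, as a set of elements of `𝕀_{3,n}` (row 101's `plIndex n`); also [Hu22] (9.3) p.131 l.32–33. secondary:
restated from Lafforgue2003; primary unread. [claim: Hu2025, status: under-review]
STATUS: candidate statement under adjudication (D-0012/D-0089); not asserted. -/
def GammaOfMatroid {n : ℕ} (M : HuMatroid n 3) : Set (plIndex n) :=
  {u | ¬ VertexMem M (tripleSet n u.1)}

/-- **Hu 2025, (9.2)** — numbered alias of `GammaOfMatroid` (chunk p0072 l.133–135; PDF p.161 eq. (9.2)).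
[claim: Hu2025, status: under-review]
STATUS: candidate statement under adjudication (D-0012/D-0089); not asserted. -/
abbrev Eq9_2 {n : ℕ} (M : HuMatroid n 3) : Set (plIndex n) := GammaOfMatroid M

/-- **`Γ_d` as a subset of `Var_𝐔`** (Def. 7.1, chunk p0057 l.9–13: «Let `Γ` be an arbitrary subset of
`Var_𝐔 = {x_u ∣ u ∈ 𝕀_{3,n} ∖ m}`»; (9.2) with chunk p0072 l.128–130 «`x_m ∈ Δ^{3,n}_d` … `m` can be assumed to be
`(123)`», so `m ∉ Γ_d`): the trace of `Γ_d` on row 101's chart-variable indices `plVar n = 𝕀_{3,n} ∖ {(123)}` — the `Γ`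
fed to `S07GammaSchemes.GammaSchemeRing` / `S08MainTheorem.gammaSpec`. OURS bookkeeping of the identification
`u ↦ x_u`. [claim: Hu2025, status: under-review]
STATUS: candidate statement under adjudication (D-0012/D-0089); not asserted. -/
def GammaOfMatroidVar {n : ℕ} (M : HuMatroid n 3) : Set (plVar n) :=
  {x | ¬ VertexMem M (tripleSet n x.1)}

/-- **Hu 2025, §9, unnumbered claim before (9.2)** (chunk p0072 l.128–130; PDF p.161 L016–L020; the first sentence is also
[Hu22] p.131 l.29–31, which prints NO «(By permutation …)» parenthetical — that WLOG is [Hu25] chunk p0072 l.130 = C72L130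
only), verbatim: «Since `Δ^{3,n}_d ≠ ∅`, there exists `m ∈ 𝕀_{3,n}` such that `x_m ∈ Δ^{3,n}_d`. (By permutation if
necessary, `m` can be assumed to be `(123)`.)» Typed: non-emptiness of the (real) matroid subpolytope gives a triple
`m ∈ 𝕀_{3,n}` with `x_m ∈ Δ^{3,n}_d` (combinatorial form `VertexMem`). The parenthetical WLOG (C72L130) is a renaming, not
typed. secondary: restated from Lafforgue2003; primary unread. [claim: Hu2025, status: under-review]
STATUS: candidate statement under adjudication (D-0012/D-0089); not asserted. -/
def C72L129 {n : ℕ} (M : HuMatroid n 3) : Prop :=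
  (matroidPolytope M).Nonempty → ∃ m : plIndex n, VertexMem M (tripleSet n m.1)

/-! ## [Hu22] p.131 l.27–45 — diagram (9.2), (9.3) and the sentence P131L40 (joint J1 = G-H7's printed reason) -/

/-- **The setting of [Hu22] p.131 l.4–41 (proof of [Hu22] Thm 9.5), as PRINTED** — diagram (9.2) and (9.3): «First, we
assume that `X` is defined over `Spec ℤ`. We apply Theorem 9.4 to `X` … We identify `U ⊂ X × 𝔸^r` with the quotient
space `Gr̄^{3,E}_d = Gr^{3,E}_d/(𝔾ⁿ_m/𝔾_m)`. Consider the quotient map `π : Gr^{3,E}_d → Gr̄^{3,E}_d`. We have the diagram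
(9.2) `Gr^{3,E}_d ↠ Gr̄^{3,E}_d ≅ U ↪ X × 𝔸^r → X`. We can apply Proposition 9.1 … there exists `m ∈ 𝕀_{3,n}` such that
`x_m ∈ Δ^{3,n}_d`. We define (9.3) `Γ := Γ_d = {i ∈ 𝕀_{3,n} ∣ x_i ∉ Δ^{3,n}_d}`. Then … `Gr^{3,E}_d` is an open subset of
the Γ-scheme `Z_Γ ⊂ 𝐔_m`.» Fields = exactly these printed data/properties, over the base field `𝔽` of [Hu25] §8
(C67L4; [Hu22] uses `𝔽` on p.132 l.49) and row 101's platform with `m = (123)` ([Hu22] p.131 l.29–31 prints only «there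
exists `m ∈ 𝕀_{3,n}` such that `x_m ∈ Δ^{3,n}_d`»; the normalisation «(By permutation if necessary, `m` can be assumed to be
`(123)`)» is [Hu25] chunk p0072 l.130 = C72L130, and `m = (123)` is the platform's chart choice of row 101, `mTri`): `X`
with `U` open in `X × 𝔸^r` onto `X` (Thm 9.4), the cell `Gr^{3,E}_d` with the quotient map `π` onto `U`
(printed `↠`, surjective) and an OPEN IMMERSION into `Z_Γ = gammaSpec (primaryFamily n 𝔽) (Γ_d ∩ Var_𝐔)`. **Nothing
beyond these printed properties ties an inhabitant to Lafforgue's construction (none is given in print); EXISTENCE NOT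
SHOWN here.** Universe `0`. [claim: Hu2022, status: under-review]
STATUS: candidate statement under adjudication (D-0012/D-0089); not asserted. -/
structure Hu22Setup (𝔽 : Type) [Field 𝔽] (n : ℕ) (M : HuMatroid n 3) where
  /-- the scheme `X` of [Hu22] Thm 9.5 («affine … over a perfect field `k`»; «defined over `Spec ℤ`») -/
  X : Scheme.{0}
  /-- the «positive integer `r`» of Thm 9.4 -/
  r : ℕ
  /-- «an open subset `U ⊂ X × 𝔸^r`» -/
  U : (𝔸(Fin r; X)).Opens
  /-- «projecting onto `X`» (Thm 9.4; «surjectively», Thm 9.2) -/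
  U_onto : _root_.AlgebraicGeometry.Surjective (U.ι ≫ (𝔸(Fin r; X) ↘ X))
  /-- the matroid Schubert cell `Gr^{3,E}_d` as a scheme -/
  cell : Scheme.{0}
  /-- «the quotient map `π : Gr^{3,E}_d → Gr̄^{3,E}_d`», composed with «`Gr̄^{3,E}_d ≅ U`» (diagram (9.2)) -/
  quot : cell ⟶ (U : Scheme.{0})
  /-- printed `↠` in (9.2): the quotient map is onto -/
  quot_surjective : _root_.AlgebraicGeometry.Surjective quot
  /-- «there exists `m ∈ 𝕀_{3,n}` such that `x_m ∈ Δ^{3,n}_d`» ([Hu22] p.131 l.29–31), at `m = (123)` ([Hu25] C72L130; row 101's `mTri`) -/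
  m_mem : VertexMem M (tripleSet n mTri)
  /-- «`Gr^{3,E}_d` is an open subset of the Γ-scheme `Z_Γ ⊂ 𝐔_m`», `Γ = Γ_d` (9.3) -/
  cellToGamma : cell ⟶ gammaSpec (primaryFamily n 𝔽) (GammaOfMatroidVar M)
  /-- … an open immersion -/
  cellToGamma_isOpenImmersion : IsOpenImmersion cellToGamma

/-- **Hu 2022 (arXiv:2203.03842v4), p.131 l.40–41** (joint J1 = G-H7's printed reason), verbatim: «As `X` is integral (by
assumption), one sees that `Z_Γ` is integral.» Typed as the INFERENCE it states, over the printed setting `S : Hu22Setup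
𝔽 n d` (diagram (9.2), (9.3), «`Gr^{3,E}_d` is an open subset of `Z_Γ`»): `X` integral ⇒ `Z_Γ` integral (Mathlib
`IsIntegral`), `Z_Γ = gammaSpec (primaryFamily n 𝔽) (Γ_d ∩ Var_𝐔)`. No side is taken on whether it follows (tree
index only: `Literature/AlgebraicGeometry/Hu2025/GammaSchemeNotIntegral*.lean` are kernel statements about explicit `Γ`,
never premises here). [claim: Hu2022, status: under-review]
STATUS: candidate statement under adjudication (D-0012/D-0089); not asserted. -/
def Hu22P131L40 {𝔽 : Type} [Field 𝔽] {n : ℕ} {M : HuMatroid n 3} (S : Hu22Setup 𝔽 n M) : Prop :=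
  IsIntegral S.X → IsIntegral (gammaSpec (primaryFamily n 𝔽) (GammaOfMatroidVar M))

/-! ## C09L16 (chunk p0009 l.16–19; PDF p.17) instantiated with this typing's decls -/

/-- **C09L16 instantiated with this typing's decls** (same locator): for a datum `L` of Lafforgue's objects, «Thm 1.3 (in
the closed consequence form `S08MainTheorem.Thm1_3_admitsResolution` of file d: `Z_Γ` integral and singular ⇒ `Z_Γ` admits a
resolution) ∧ Thm 9.2 (for `L`) ∧ Thm 9.4 (for `L`) ⇒ Thm 1.1» in universe `0`. The choice of the Thm-1.3 form is a
READING (the tower form `S08MainTheorem.Thm1_3` is a property of a given tower); labelled.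
[claim: Hu2025, status: under-review]
STATUS: candidate statement under adjudication (D-0012/D-0089); not asserted. -/
def C09L16_inst (L : LafforgueObjects) : Prop :=
  C09L16.{0} Thm1_3_admitsResolution (Thm9_2 L) (Thm9_4 L)

/-! ## PARTITION-HU §7.2 spells J1's Thm 1.3 as `S01S09Interface.Thm1_3`: the declaration of record is file d's
`S08MainTheorem.Thm1_3` (p514976; likewise `Thm1_3_admitsResolution`). `export` makes the §7.2 spelling resolve to that ONE
constant — no second constant is declared (review of p517728: a duplicate constant is ambiguous for any consumer that opens both
namespaces); res-dag-2 is asked to key the read-list entry to `S08MainTheorem.Thm1_3`. -/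

export Literature.AlgebraicGeometry.Hu2025.Statements.S08MainTheorem (Thm1_3 Thm1_3_admitsResolution)

end Literature.AlgebraicGeometry.Hu2025.Statements.S01S09Interface

end
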